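import Mathlib
import Literature.NumberTheory.Transcendental.KZHyperbolicLadder
import Literature.NumberTheory.Transcendental.KZIdealTetrahedron

/-!
# Stub `idealTetrahedron_isGeodesicPolytope`
# (crux `OffTetraSectorKernel`, line `odd-hyperbolic-ladder`)

Rung `n = 2` of Goncharov's hyperbolic scissors ladder is `ℍ³` in the upper half-space model
`{p : Fin 3 → ℝ | 0 < p 2}` with density `t⁻³`. The crux's oracle solids, the ideal
tetrahedra `T(z) = idealTetrahedron z` with vertices `∞, 0, 1, z` (`z` algebraic, `Im z > 0`),
are `ℚ̄`-geodesic polytopes of that rung (`KZ.IsGeodesicPolytope 2`): `T(z)` is cut out of the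
upper half-space by three vertical half-planes (over the sides of the boundary triangle
`0, 1, z`) and one hemisphere (centred at the circumcentre `(1/2, -κ/2)` of that triangle,
`κ = (Re z − |z|²) / Im z`, squared radius `1/4 + κ²/4`), all with real-algebraic data, and
`t⁻³` is integrable on it (`integrableOn_one_div_cube_idealTetrahedron`). This is the
non-vacuity / consistency check "rung `2` contains the Bloch–Wigner sector".
-/

noncomputable section

open Set MeasureTheory

namespace Summit.KontsevichZagierPeriods.HyperbolicBloch.OffTetraSectorKernel

open Literature.NumberTheory.Transcendental in
/-- **The ideal tetrahedra are rung-`2` polytopes.** For `z` algebraic with `Im z > 0`, the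
ideal tetrahedron `T(∞, 0, 1, z)` of `ℍ³` is a finite-volume `ℚ̄`-geodesic polytope of the
upper half-space: three vertical faces `0 < y`, `Re z · y < Im z · x`,
`Im z · (x − 1) < (Re z − 1) · y` and the hemisphere
`(x − 1/2)² + (y + κ/2)² + t² > 1/4 + κ²/4`, `κ = (Re z − |z|²)/Im z`, with algebraic
parameters, and `∫_{T(z)} t⁻³ < ∞`. [cite: Goncharov1999, §1.1] -/
theorem idealTetrahedron_isGeodesicPolytope : ∀ z : ℂ, IsAlgebraic ℚ z → 0 < z.im → Literature.NumberTheory.Transcendental.KZ.IsGeodesicPolytope 2 (Literature.NumberTheory.Transcendental.idealTetrahedron z) := by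
  intro z hz him
  obtain ⟨hre, hia⟩ := isAlgebraic_re_im hz
  -- the hemisphere through `0, 1, z` is centred at `(1/2, -κ/2, 0)`
  set κ : ℝ := (z.re - Complex.normSq z) / z.im with hκ
  have hκalg : IsAlgebraic ℚ κ := by
    have h1 : IsAlgebraic ℚ (Complex.normSq z) := by
      rw [Complex.normSq_apply]; exact (hre.mul hre).add (hia.mul hia)
    rw [hκ, div_eq_mul_inv]; exact (hre.sub h1).mul hia.inv
  have h2 : IsAlgebraic ℚ (1 / 2 : ℝ) := by
    rw [one_div]; exact (isAlgebraic_nat 2).inv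
  have h2' : IsAlgebraic ℚ (-(κ / 2) : ℝ) := by
    rw [div_eq_mul_inv]; exact (hκalg.mul (isAlgebraic_nat 2).inv).neg
  have h4 : IsAlgebraic ℚ (1 / 4 + κ ^ 2 / 4 : ℝ) := by
    rw [one_div, div_eq_mul_inv]
    exact (isAlgebraic_nat 4).inv.add ((hκalg.pow 2).mul (isAlgebraic_nat 4).inv)
  refine ⟨4, ![true, true, true, false],
    ![![0, 1, 0], ![z.im, -z.re, 0], ![-z.im, z.re - 1, 0], ![1 / 2, -(κ / 2), 0]],
    ![0, 0, -z.im, 1 / 4 + κ ^ 2 / 4], fun _ => 1, ?_, ?_, fun _ => Or.inl rfl, ?_, ?_, ?_⟩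
  · intro i l
    fin_cases i <;> fin_cases l
    exacts [isAlgebraic_zero, isAlgebraic_one, isAlgebraic_zero, hia, hre.neg, isAlgebraic_zero,
      hia.neg, hre.sub isAlgebraic_one, isAlgebraic_zero, h2, h2', isAlgebraic_zero]
  · intro i
    fin_cases i
    exacts [isAlgebraic_zero, isAlgebraic_zero, hia.neg, h4]
  · intro i
    fin_cases i <;> rfl
  · ext p
    simp only [idealTetrahedron, Set.mem_setOf_eq]
    have hlast : p (Fin.last 2) = p 2 := rfl
    have hvκ : z.im * κ = z.re - Complex.normSq z := by
      rw [hκ]; field_simp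
    have hround : (∑ l : Fin 3, (p l - ![1 / 2, -(κ / 2), 0] l) ^ 2) - (1 / 4 + κ ^ 2 / 4) =
        p 0 ^ 2 + p 1 ^ 2 + p 2 ^ 2 - p 0 + κ * p 1 := by
      simp only [Fin.sum_univ_three, Matrix.cons_val_zero, Matrix.cons_val_one, Matrix.cons_val_two,
        Matrix.head_cons, Matrix.tail_cons]
      ring
    have hkey : 0 < p 0 ^ 2 + p 1 ^ 2 + p 2 ^ 2 - p 0 + κ * p 1 ↔
        0 < z.im * (p 0 ^ 2 + p 1 ^ 2 + p 2 ^ 2 - p 0) + (z.re - Complex.normSq z) * p 1 := by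
      have : z.im * (p 0 ^ 2 + p 1 ^ 2 + p 2 ^ 2 - p 0) + (z.re - Complex.normSq z) * p 1 =
          z.im * (p 0 ^ 2 + p 1 ^ 2 + p 2 ^ 2 - p 0 + κ * p 1) := by rw [← hvκ]; ring
      rw [this]
      exact ⟨fun h => mul_pos him h, fun h => pos_of_mul_pos_right h him.le⟩
    rw [Fin.forall_fin_succ, Fin.forall_fin_succ, Fin.forall_fin_succ, Fin.forall_fin_one]
    simp only [Matrix.cons_val_zero, Matrix.cons_val_succ, one_mul, hlast]
    simp only [if_true, Bool.false_eq_true, if_false]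
    rw [hround, hkey, Fin.sum_univ_three, Fin.sum_univ_three, Fin.sum_univ_three]
    simp only [Matrix.cons_val_zero, Matrix.cons_val_one, Matrix.cons_val_two,
      Matrix.head_cons, Matrix.tail_cons]
    constructor
    · rintro ⟨hy, hxy, hx1, ht, hs⟩
      exact ⟨ht, by linarith, by linarith, by linarith, hs⟩
    · rintro ⟨ht, hy, hxy, hx1, hs⟩
      exact ⟨by linarith, by linarith, by linarith, ht, hs⟩
  · -- finite hyperbolic volume: `hypDensity 2 = fun p => 1 / p 2 ^ 3` definitionally
    exact integrableOn_one_div_cube_idealTetrahedron him
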